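import Literature.NumberTheory.Transcendental.AndreCriterionAnalyticProofs
import Literature.NumberTheory.EllipticCurves.UniformizationUniqueProofs
import Literature.NumberTheory.EllipticCurves.FormalGroupLawAxiomsUniversalProofs
import Mathlib.Analysis.Analytic.IsolatedZeros
import HarnessLib

/-!
# The formal exponential is the Taylor series of the local parameter along the uniformisation:
# `𝓣[t ∘ u] = exp_W`, `t = -x/y` (the formal leaf of Bost's foliation IS the analytic leaf; proofs only)

Topic `Literature/NumberTheory/EllipticCurves`; a proofs-only file (theorems only, no definition,
no named fact). For a Weierstrass model `W/ℂ`, a period pair `L` of Néron type for it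
(`g₂ = c₄/12`, `g₃ = c₆/216`) and the analytic uniformisation
`u(z) = (x(z), y(z)) = (℘(z) - b₂/12, (℘'(z) - a₁x(z) - a₃)/2)` (Silverman AEC VI.3.6, the
tree's `PeriodPair.exists_addMonoidHom_of_g₂_g₃'`), the local parameter `t = -x/y` of AEC IV.1
along `u` is the meromorphic function

  `𝔱(z) = -x(z) / y(z)`  (`z ∉ Λ`),  `𝔱(z) = 0`  (`z ∈ Λ`),

and likewise `𝔴(z) = -1/y(z)` (`w = -1/y`). We prove that `𝔱` is analytic at `0` with
`𝔱(0) = 0`, `𝔱'(0) = 1`, and that **its Taylor series at `0` is the formal exponential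
`exp_W ∈ ℂ⟦z⟧` of the formal group of `W`** (`taylor_localParam_eq_formalExp`), i.e.
`log_W(𝓣[𝔱]) = z`: the invariant differential `ω = dx/(2y + a₁x + a₃)` pulls back to `dz` under
`u`. Consequently, for two such `(W₁, L₁)`, `(W₂, L₂)`, the strict formal isomorphism
`y = exp_{W₂}(log_{W₁} x)` of the formal groups over `ℚ ⊂ ℂ` — the formal leaf through the origin
of Bost's line `h ⊂ Lie E₁ ⊕ Lie E₂` — satisfies **`y(𝓣[𝔱₁]) = 𝓣[𝔱₂]`**
(`formalExp_subst_formalLog_subst_taylor`), which is the "simultaneous uniformisation"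
hypothesis `y(φ̂) = ψ̂` of André's criterion in the tree's form
(`Transcendental/AndreCriterionAnalyticProofs`, hypothesis `hy`) for
`(φ, ψ) = (𝔱₁, 𝔱₂)`. This is the identification of the formal leaf with the analytic one in
Bost's proof of the isogeny theorem for elliptic curves over `ℚ` (Publ. Math. IHÉS 93 (2001),
§3.4.1: "the series defining `ψ` … hence `φ` [have positive radii]; the formal germ `V̂` is
analytic", and Thm. 2.3, condition ii): "the exponential map of the complex Lie group").

The argument (Silverman AEC IV.1 read analytically): near `0`, `x = z⁻² + O(1)`,
`2y = -2z⁻³ + O(z⁻²)`, so `𝔱 = N/Q`, `𝔴 = 2z³/Q` with `N, Q` analytic, `Q(0) = 2`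
(`localParam_eventuallyEq`); the Weierstrass equation divided by `y³` is the fixed-point
equation `𝔴 = 𝔱³ + a₁𝔱𝔴 + a₂𝔱²𝔴 + a₃𝔴² + a₄𝔱𝔴² + a₆𝔴³` of AEC IV.1.1, so
`𝓣[𝔴] = w(𝓣[𝔱])` for the tree's `formalW` by uniqueness of the fixed point
(`fixedPoint_unique` of `FormalGroupNegProofs`); and `x' = ℘' = 2y + a₁x + a₃` (Mathlib
`deriv_weierstrassP`) reads
`𝔱'𝔴 - 𝔱𝔴' = 𝔴(-2 + a₁𝔱 + a₃𝔴)`, which with `w - z w' = -z³(2B + zB')`,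
`w(-2 + a₁z + a₃w) = -z³B(2 - a₁z - a₃z³B)` (`B = w/z³`) is `T̂'·ω(T̂) = 1` for the tree's
`formalOmega = (2B + zB')/(B(2 - a₁z - a₃z³B))`; hence `(log_W(T̂))' = 1`, `log_W(T̂) = z`,
`T̂ = exp_W` (`eq_formalExp_of_flow`).

## References

* J.-B. Bost, *Algebraic leaves of algebraic foliations over number fields*, Publ. Math. IHÉS 93
  (2001), §2.3.1 (proof of Thm. 2.3: condition ii) via the exponential map), §3.4.1, Cor. 2.5.
  [Bost2001AlgebraicLeaves]
* J. H. Silverman, *AEC* 2nd ed. (2009), IV.1 (`z = -x/y`, `w = -1/y`, `w = f(z, w)`, the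
  expansions of `x, y, ω`), IV.5 (`log`, `exp`), VI.3.6 (uniformisation). [SilvermanAEC2009]
* A. Chambert-Loir, Sém. Bourbaki 886 (2002), §6.1 (uniformisation simultanée). [ChambertLoir2002Bourbaki]
-/

noncomputable section

open PowerSeries Filter Set Literature.NumberTheory.Transcendental.AndreCriterion
open scoped Topology Nat Classical

/-- The Taylor series of `f : ℂ → ℂ` at `0` (local notation, as in
`AndreCriterionAnalyticProofs`). -/
local notation3 "𝓣[" f "]" =>
  (PowerSeries.mk fun n => ((Nat.factorial n : ℂ)⁻¹ * iteratedDeriv n f 0) : PowerSeries ℂ)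

namespace Literature.NumberTheory.EllipticCurves

/-! ### More Taylor-series calculus -/

section Taylor

variable {f g : ℂ → ℂ}

/-- The Taylor series of a derivative is the formal derivative. [folklore] -/
theorem taylor_deriv (f : ℂ → ℂ) :
    (PowerSeries.mk fun n => ((Nat.factorial n : ℂ)⁻¹ * iteratedDeriv n (deriv f) 0) : PowerSeries ℂ) =
      d⁄dX ℂ 𝓣[f] := by
  ext n
  rw [coeff_mk, coeff_derivative, coeff_mk, iteratedDeriv_succ', Nat.factorial_succ]
  push_cast
  have hn : ((n : ℂ) + 1) ≠ 0 := by exact_mod_cast Nat.succ_ne_zero n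
  have hf : (n ! : ℂ) ≠ 0 := by exact_mod_cast Nat.factorial_ne_zero n
  field_simp

/-- Subtraction of Taylor series. [folklore] -/
theorem taylor_sub (hf : AnalyticAt ℂ f 0) (hg : AnalyticAt ℂ g 0) :
    𝓣[f - g] = 𝓣[f] - 𝓣[g] := by
  ext n
  rw [map_sub, coeff_mk, coeff_mk, coeff_mk, iteratedDeriv_sub hf.contDiffAt hg.contDiffAt, mul_sub]

/-- The Taylor series of a constant. [folklore] -/
theorem taylor_const (c : ℂ) : 𝓣[(fun _ : ℂ => c)] = C c := by
  ext n
  rw [coeff_mk, iteratedDeriv_const, coeff_C]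
  split_ifs with h
  · subst h; simp
  · simp

end Taylor

end Literature.NumberTheory.EllipticCurves

namespace WeierstrassCurve

open Literature.NumberTheory.EllipticCurves

/-! ### The formal side: fixed point, `ω`, and `T̂ = exp_W` from the two identities -/

section Formal

variable {A : Type*} [CommRing A] (V : WeierstrassCurve A)

/-- Substitution fixes constants (`AlgHom` form). [folklore] -/
theorem _root_.Literature.NumberTheory.EllipticCurves.substAlgHom_C {T : A⟦X⟧} (hs : HasSubst T)
    (r : A) : substAlgHom hs (C r) = C r := by
  rw [C_eq_algebraMap]
  exact AlgHom.commutes _ r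

/-- **`f(T, ·)` after substituting `z ↦ T`**: `(f(w))(T) = T³ + a₁T·w(T) + ⋯ + a₆w(T)³`. [folklore] -/
theorem formalWStep_subst {T : A⟦X⟧} (hT : constantCoeff T = 0) (w : A⟦X⟧) :
    (V.formalWStep w).subst T = T ^ 3 + C V.a₁ * T * w.subst T + C V.a₂ * T ^ 2 * w.subst T +
      C V.a₃ * w.subst T ^ 2 + C V.a₄ * T * w.subst T ^ 2 + C V.a₆ * w.subst T ^ 3 := by
  have hs : HasSubst T := HasSubst.of_constantCoeff_zero' hT
  rw [formalWStep, ← coe_substAlgHom hs]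
  simp only [map_add, map_mul, map_pow, substAlgHom_X hs, substAlgHom_C hs]

/-- `w(T)` is a fixed point of `f(T, ·)`. [Silverman AEC IV.1.1(a)] [folklore] -/
theorem formalW_subst_eq_step {T : A⟦X⟧} (hT : constantCoeff T = 0) :
    V.formalW.subst T = T ^ 3 + C V.a₁ * T * V.formalW.subst T + C V.a₂ * T ^ 2 * V.formalW.subst T +
      C V.a₃ * V.formalW.subst T ^ 2 + C V.a₄ * T * V.formalW.subst T ^ 2 +
        C V.a₆ * V.formalW.subst T ^ 3 := by
  conv_lhs => rw [← V.formalWStep_formalW]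
  exact V.formalWStep_subst hT _

/-- `w - z·w' = -z³(2B + zB')` (`w = z³B`, `B = formalWDivCube`). [folklore] -/
theorem formalW_sub_X_mul_derivative :
    V.formalW - X * d⁄dX A V.formalW =
      -(X ^ 3 * (2 * V.formalWDivCube + X * d⁄dX A V.formalWDivCube)) := by
  rw [V.formalW_eq_X_pow_mul_formalWDivCube, Derivation.leibniz, Derivation.leibniz_pow, derivative_X,
    smul_eq_mul, smul_eq_mul, smul_eq_mul, mul_one, nsmul_eq_mul]
  push_cast
  ring

/-- `w·(-2 + a₁z + a₃w) = -z³·B(2 - a₁z - a₃z³B)`. [folklore] -/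
theorem formalW_mul_neg_two_add :
    V.formalW * (-2 + C V.a₁ * X + C V.a₃ * V.formalW) =
      -(X ^ 3 * (V.formalWDivCube * (2 - C V.a₁ * X - C V.a₃ * X ^ 3 * V.formalWDivCube))) := by
  rw [V.formalW_eq_X_pow_mul_formalWDivCube]
  ring

variable {V} in
/-- **`ω · B(2 - a₁z - a₃z³B) = 2B + zB'`** for the tree's invariant differential
`formalOmega = (2B + zB')/(B(2 - a₁z - a₃z³B))` (over a `ℚ`-algebra). [Silverman AEC IV.1
(`ω = dx/(2y + a₁x + a₃)` in the parameter `z`)] [folklore] -/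
theorem formalOmega_mul_formalWDivCube_mul [Algebra ℚ A] (V : WeierstrassCurve A) :
    V.formalOmega * (V.formalWDivCube * (2 - C V.a₁ * X - C V.a₃ * X ^ 3 * V.formalWDivCube)) =
      2 * V.formalWDivCube + X * d⁄dX A V.formalWDivCube := by
  have hD : constantCoeff (V.formalWDivCube * (2 - C V.a₁ * X - C V.a₃ * X ^ 3 * V.formalWDivCube)) =
      ((unitTwo : Aˣ) : A) := by
    have h2 : constantCoeff (2 : A⟦X⟧) = 2 := map_ofNat _ 2
    rw [show ((unitTwo : Aˣ) : A) = 2 from rfl]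
    simp [h2]
  unfold formalOmega
  rw [mul_assoc, mul_comm (invOfUnit _ _), mul_invOfUnit _ _ hD, mul_one]

/-- In a `ℚ`-algebra, series with equal derivatives and equal constant terms are equal.
[folklore] -/
theorem _root_.Literature.NumberTheory.EllipticCurves.eq_of_derivative_eq_of_constantCoeff_eq [Algebra ℚ A]
    {f g : A⟦X⟧} (hd : d⁄dX A f = d⁄dX A g) (h0 : constantCoeff f = constantCoeff g) : f = g := by
  ext n
  cases n with
  | zero => simpa using h0
  | succ n =>
    have h := congrArg (coeff n) hd
    rw [coeff_derivative, coeff_derivative] at h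
    have hu : IsUnit ((n : A) + 1) := by
      have : IsUnit (algebraMap ℚ A ((n : ℚ) + 1)) :=
        (isUnit_iff_ne_zero.mpr (by positivity)).map _
      rwa [map_add, map_natCast, map_one] at this
    exact hu.mul_left_inj.mp h

/-- **`T̂ = exp_W` from the two identities of the flow.** Let `V` be a Weierstrass model over a
`ℚ`-algebra without zero divisors, `T = z + O(z²)` and `Y` (no constant term) power series with
(E1) `Y = T³ + a₁TY + a₂T²Y + a₃Y² + a₄TY² + a₆Y³` (the Weierstrass equation in `(t, w)`) and
(E2) `T'Y - TY' = Y(-2 + a₁T + a₃Y)` (`dx = ω`, i.e. `x' = 2y + a₁x + a₃`). Then `Y = w(T)`,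
`T'·ω(T) = 1`, `log_V(T) = z` and `T = exp_V`. [Silverman AEC IV.1, IV.5] [folklore] -/
theorem eq_formalExp_of_flow [Algebra ℚ A] [IsDomain A] {T Y : A⟦X⟧} (hT0 : constantCoeff T = 0)
    (hT1 : coeff 1 T = 1) (hY0 : constantCoeff Y = 0)
    (hE1 : Y = T ^ 3 + C V.a₁ * T * Y + C V.a₂ * T ^ 2 * Y + C V.a₃ * Y ^ 2 +
      C V.a₄ * T * Y ^ 2 + C V.a₆ * Y ^ 3)
    (hE2 : d⁄dX A T * Y - T * d⁄dX A Y = Y * (-2 + C V.a₁ * T + C V.a₃ * Y)) :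
    T = V.formalExp := by
  have hs : HasSubst T := HasSubst.of_constantCoeff_zero' hT0
  -- `Y = w(T)` (uniqueness of the fixed point, AEC IV.1.1: `fixedPoint_unique`)
  have hY : Y = V.formalW.subst T :=
    V.fixedPoint_unique hT0 hY0 (PowerSeries.constantCoeff_subst_eq_zero hT0 _ V.constantCoeff_formalW) hE1
      (V.formalW_subst_eq_step hT0)
  -- rewrite (E2) through `w`, `B` and cancel `T³`
  have hL : d⁄dX A T * Y - T * d⁄dX A Y = d⁄dX A T * (V.formalW - X * d⁄dX A V.formalW).subst T := by
    rw [hY, derivative_subst A hs, ← coe_substAlgHom hs, map_sub, map_mul, substAlgHom_X hs,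
      coe_substAlgHom hs]
    ring
  have hR : Y * (-2 + C V.a₁ * T + C V.a₃ * Y) =
      (V.formalW * (-2 + C V.a₁ * X + C V.a₃ * V.formalW)).subst T := by
    have h2 : substAlgHom (R := A) hs (2 : A⟦X⟧) = 2 := map_ofNat _ 2
    rw [hY, ← coe_substAlgHom hs]
    simp only [map_add, map_mul, map_neg, substAlgHom_X hs, substAlgHom_C hs, h2]
  rw [hL, hR, formalW_sub_X_mul_derivative, formalW_mul_neg_two_add, ← coe_substAlgHom hs,
    map_neg, map_neg, map_mul, map_mul, map_pow, substAlgHom_X hs, coe_substAlgHom hs, mul_neg,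
    neg_inj, ← mul_assoc, mul_comm (d⁄dX A T) (T ^ 3), mul_assoc] at hE2
  have hT0' : T ≠ 0 := fun h => by simp [h] at hT1
  have h3 := mul_left_cancel₀ (pow_ne_zero 3 hT0') hE2
  -- `T'·num(T) = den(T)` and `num = ω·den`, so `T'·ω(T) = 1`
  rw [← V.formalOmega_mul_formalWDivCube_mul, subst_mul hs, ← mul_assoc] at h3
  haveI : CharZero A := charZero_of_injective_algebraMap (algebraMap ℚ A).injective
  have hden0 : (V.formalWDivCube * (2 - C V.a₁ * X - C V.a₃ * X ^ 3 * V.formalWDivCube)).subst T ≠ 0 := by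
    intro h
    have h1 := congrArg constantCoeff h
    rw [constantCoeff_subst_of_constantCoeff_eq_zero hT0, map_zero] at h1
    have h2' : constantCoeff (2 : A⟦X⟧) = 2 := map_ofNat _ 2
    have h2 : constantCoeff (V.formalWDivCube * (2 - C V.a₁ * X - C V.a₃ * X ^ 3 * V.formalWDivCube))
        = (2 : A) := by simp [h2']
    rw [h2] at h1
    exact two_ne_zero h1
  have h4 : d⁄dX A T * V.formalOmega.subst T = 1 :=
    mul_right_cancel₀ hden0 (h3.trans (one_mul _).symm)
  -- `log_V(T) = z`
  have hlog : V.formalLog.subst T = X := by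
    refine eq_of_derivative_eq_of_constantCoeff_eq ?_ ?_
    · rw [derivative_subst A hs, derivative_formalLog, derivative_X, mul_comm, h4]
    · rw [constantCoeff_X]
      exact PowerSeries.constantCoeff_subst_eq_zero hT0 _ V.constantCoeff_formalLog
  -- `T = exp_V`
  have h5 : PowerSeries.subst T (V.formalExp.subst V.formalLog) = T := by
    rw [formalExp_subst_formalLog, subst_X hs]
  rw [PowerSeries.subst_comp_subst_apply V.hasSubst_formalLog hs, hlog, X_subst] at h5
  exact h5.symm

end Formal

/-! ### The analytic side: `t = -x/y` and `w = -1/y` along the uniformisation, near `z = 0` -/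

section Analytic

open PeriodPair

variable (L : PeriodPair) (W : WeierstrassCurve ℂ)

/-- The Weierstrass equation for `(x, y) = (℘ - b₂/12, (℘' - a₁x - a₃)/2)` on a Néron pair:
`(2y + a₁x + a₃)² = 4x³ + b₂x² + 2b₄x + b₆` is `℘'² = 4℘³ - g₂℘ - g₃`. [Silverman AEC III.1,
VI.3.5(b)] [folklore] -/
theorem equation_weierstrassP_sub (h₂ : L.g₂ = W.c₄ / 12) (h₃ : L.g₃ = W.c₆ / 216) {z : ℂ}
    (hz : z ∉ L.lattice) :
    ((℘'[L] z - W.a₁ * (℘[L] z - W.b₂ / 12) - W.a₃) / 2) ^ 2 +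
        W.a₁ * (℘[L] z - W.b₂ / 12) * ((℘'[L] z - W.a₁ * (℘[L] z - W.b₂ / 12) - W.a₃) / 2) +
        W.a₃ * ((℘'[L] z - W.a₁ * (℘[L] z - W.b₂ / 12) - W.a₃) / 2) =
      (℘[L] z - W.b₂ / 12) ^ 3 + W.a₂ * (℘[L] z - W.b₂ / 12) ^ 2 + W.a₄ * (℘[L] z - W.b₂ / 12) +
        W.a₆ := by
  have h := L.derivWeierstrassP_sq z hz
  rw [h₂, h₃] at h
  simp only [WeierstrassCurve.c₄, WeierstrassCurve.c₆, WeierstrassCurve.b₂, WeierstrassCurve.b₄,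
    WeierstrassCurve.b₆] at h ⊢
  linear_combination (1 / 4 : ℂ) * h

/-- **`t = -x/y` and `w = -1/y` near `0` are `N/Q` and `2z³/Q`** with
`N = 2z + 2z³(℘₀ - b₂/12)`, `Q = 2 + a₁z + a₁z³(℘₀ - b₂/12) + a₃z³ - z³℘₀'`, where
`℘₀ = ℘ - z⁻²`, `℘₀' = ℘' + 2z⁻³` are the analytic parts at `0` (`x = z⁻² - a₁… `, AEC IV.1).
[Silverman AEC IV.1] [folklore] -/
theorem localParam_eventuallyEq :
    ((fun z => if z ∈ L.lattice then (0 : ℂ) else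
        -(℘[L] z - W.b₂ / 12) / ((℘'[L] z - W.a₁ * (℘[L] z - W.b₂ / 12) - W.a₃) / 2)) =ᶠ[𝓝 0]
      (fun z => (2 * z + 2 * z ^ 3 * (℘[L - (0 : ℂ)] z - W.b₂ / 12)) /
        (2 + W.a₁ * z + W.a₁ * z ^ 3 * (℘[L - (0 : ℂ)] z - W.b₂ / 12) + W.a₃ * z ^ 3 -
          z ^ 3 * ℘'[L - (0 : ℂ)] z))) ∧
    ((fun z => if z ∈ L.lattice then (0 : ℂ) else
        -1 / ((℘'[L] z - W.a₁ * (℘[L] z - W.b₂ / 12) - W.a₃) / 2)) =ᶠ[𝓝 0]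
      (fun z => (2 * z ^ 3) /
        (2 + W.a₁ * z + W.a₁ * z ^ 3 * (℘[L - (0 : ℂ)] z - W.b₂ / 12) + W.a₃ * z ^ 3 -
          z ^ 3 * ℘'[L - (0 : ℂ)] z))) := by
  set E := ℘[L - (0 : ℂ)] with hE
  set E' := ℘'[L - (0 : ℂ)] with hE'
  set Q : ℂ → ℂ := fun z => 2 + W.a₁ * z + W.a₁ * z ^ 3 * (E z - W.b₂ / 12) + W.a₃ * z ^ 3 -
    z ^ 3 * E' z with hQ
  have hEa : AnalyticAt ℂ E 0 := L.analyticAt_weierstrassPExcept 0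
  have hE'a : AnalyticAt ℂ E' 0 := L.analyticAt_derivWeierstrassPExcept 0
  have hQa : AnalyticAt ℂ Q 0 := by
    rw [hQ]
    fun_prop
  have hQ0 : Q 0 = 2 := by simp [hQ]
  have hQne : ∀ᶠ z in 𝓝 0, Q z ≠ 0 := hQa.continuousAt.eventually_ne (by rw [hQ0]; exact two_ne_zero)
  have hΛ := L.compl_lattice_sdiff_singleton_mem_nhds 0
  have hP : ∀ z, ℘[L] z = E z + 1 / z ^ 2 := L.weierstrassP_eq_weierstrassPExcept_add
  have hP' : ∀ z, ℘'[L] z = E' z - 2 / z ^ 3 := L.derivWeierstrassP_eq_derivWeierstrassPExcept_sub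
  constructor
  · filter_upwards [hQne, hΛ] with z hzQ hzΛ
    by_cases hz : z = 0
    · subst hz
      simp [zero_mem]
    · have hzΛ' : z ∉ L.lattice := fun h => hzΛ ⟨h, hz⟩
      rw [if_neg hzΛ']
      have hD : (℘'[L] z - W.a₁ * (℘[L] z - W.b₂ / 12) - W.a₃) / 2 = -(Q z) / (2 * z ^ 3) := by
        rw [hP, hP', hQ]
        field_simp
        ring
      have hD0 : (℘'[L] z - W.a₁ * (℘[L] z - W.b₂ / 12) - W.a₃) / 2 ≠ 0 := by
        rw [hD]
        exact div_ne_zero (neg_ne_zero.mpr hzQ) (mul_ne_zero two_ne_zero (pow_ne_zero 3 hz))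
      rw [div_eq_div_iff hD0 hzQ, hD, hP]
      field_simp
      ring
  · filter_upwards [hQne, hΛ] with z hzQ hzΛ
    by_cases hz : z = 0
    · subst hz
      simp [zero_mem]
    · have hzΛ' : z ∉ L.lattice := fun h => hzΛ ⟨h, hz⟩
      rw [if_neg hzΛ']
      have hD : (℘'[L] z - W.a₁ * (℘[L] z - W.b₂ / 12) - W.a₃) / 2 = -(Q z) / (2 * z ^ 3) := by
        rw [hP, hP', hQ]
        field_simp
        ring
      have hD0 : (℘'[L] z - W.a₁ * (℘[L] z - W.b₂ / 12) - W.a₃) / 2 ≠ 0 := by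
        rw [hD]
        exact div_ne_zero (neg_ne_zero.mpr hzQ) (mul_ne_zero two_ne_zero (pow_ne_zero 3 hz))
      rw [div_eq_div_iff hD0 hzQ, hD]
      field_simp

/-- **The local parameter `t = -x/y` along the uniformisation is analytic at `0` with
`t(0) = 0`, and so is `w = -1/y`.** [Silverman AEC IV.1, VI.3.6] [folklore] -/
theorem analyticAt_localParam :
    AnalyticAt ℂ (fun z => if z ∈ L.lattice then (0 : ℂ) else
        -(℘[L] z - W.b₂ / 12) / ((℘'[L] z - W.a₁ * (℘[L] z - W.b₂ / 12) - W.a₃) / 2)) 0 ∧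
    AnalyticAt ℂ (fun z => if z ∈ L.lattice then (0 : ℂ) else
        -1 / ((℘'[L] z - W.a₁ * (℘[L] z - W.b₂ / 12) - W.a₃) / 2)) 0 := by
  obtain ⟨ht, hw⟩ := localParam_eventuallyEq L W
  have hEa : AnalyticAt ℂ ℘[L - (0 : ℂ)] 0 := L.analyticAt_weierstrassPExcept 0
  have hE'a : AnalyticAt ℂ ℘'[L - (0 : ℂ)] 0 := L.analyticAt_derivWeierstrassPExcept 0
  have hQa : AnalyticAt ℂ (fun z => 2 + W.a₁ * z + W.a₁ * z ^ 3 * (℘[L - (0 : ℂ)] z - W.b₂ / 12) +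
      W.a₃ * z ^ 3 - z ^ 3 * ℘'[L - (0 : ℂ)] z) 0 := by fun_prop
  have hQ0 : (fun z => 2 + W.a₁ * z + W.a₁ * z ^ 3 * (℘[L - (0 : ℂ)] z - W.b₂ / 12) +
      W.a₃ * z ^ 3 - z ^ 3 * ℘'[L - (0 : ℂ)] z) 0 ≠ 0 := by simp
  have hNa : AnalyticAt ℂ (fun z => 2 * z + 2 * z ^ 3 * (℘[L - (0 : ℂ)] z - W.b₂ / 12)) 0 := by
    fun_prop
  have hN'a : AnalyticAt ℂ (fun z : ℂ => 2 * z ^ 3) 0 := by fun_prop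
  exact ⟨(hNa.div hQa hQ0).congr ht.symm, (hN'a.div hQa hQ0).congr hw.symm⟩

/-- **`t'(0) = 1`** for the local parameter along the uniformisation (`t = z + O(z²)`).
[Silverman AEC IV.1] [folklore] -/
theorem deriv_localParam_zero :
    deriv (fun z => if z ∈ L.lattice then (0 : ℂ) else
        -(℘[L] z - W.b₂ / 12) / ((℘'[L] z - W.a₁ * (℘[L] z - W.b₂ / 12) - W.a₃) / 2)) 0 = 1 := by
  obtain ⟨ht, -⟩ := localParam_eventuallyEq L W
  rw [ht.deriv_eq]
  set E := ℘[L - (0 : ℂ)]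
  set E' := ℘'[L - (0 : ℂ)]
  have hEa : AnalyticAt ℂ E 0 := L.analyticAt_weierstrassPExcept 0
  have hE'a : AnalyticAt ℂ E' 0 := L.analyticAt_derivWeierstrassPExcept 0
  have hQa : AnalyticAt ℂ (fun z => 2 + W.a₁ * z + W.a₁ * z ^ 3 * (E z - W.b₂ / 12) +
      W.a₃ * z ^ 3 - z ^ 3 * E' z) 0 := by fun_prop
  have hN : HasDerivAt (fun z => 2 * z + 2 * z ^ 3 * (E z - W.b₂ / 12)) 2 0 := by
    have h1 : HasDerivAt (fun z : ℂ => 2 * z) 2 0 := by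
      simpa using (hasDerivAt_id (0 : ℂ)).const_mul 2
    have h2 : HasDerivAt (fun z : ℂ => 2 * z ^ 3 * (E z - W.b₂ / 12)) 0 0 := by
      have h3 : HasDerivAt (fun z : ℂ => 2 * z ^ 3) 0 0 := by
        simpa using ((hasDerivAt_pow 3 (0 : ℂ)).const_mul 2)
      have h4 : HasDerivAt (fun z => E z - W.b₂ / 12) (deriv E 0) 0 :=
        hEa.differentiableAt.hasDerivAt.sub_const _
      simpa using h3.fun_mul h4
    simpa using h1.fun_add h2
  have hQ := hQa.differentiableAt.hasDerivAt
  rw [(hN.fun_div hQ (by norm_num)).deriv]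
  norm_num

/-- Punctured facts extend across `0` when they hold at `0`. [folklore] -/
theorem _root_.Literature.NumberTheory.EllipticCurves.eventually_nhds_of_nhdsNE {P : ℂ → Prop}
    (h : ∀ᶠ z in 𝓝[≠] (0 : ℂ), P z) (h0 : P 0) : ∀ᶠ z in 𝓝 (0 : ℂ), P z := by
  rw [← nhdsNE_sup_pure (0 : ℂ), Filter.eventually_sup]
  exact ⟨h, by simpa using h0⟩

/-- `y = (℘' - a₁x - a₃)/2 ≠ 0` on a punctured neighbourhood of `0` (`y = -z⁻³ + ⋯`).
[Silverman AEC IV.1] [folklore] -/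
theorem eventually_y_ne_zero :
    ∀ᶠ z in 𝓝[≠] (0 : ℂ), (℘'[L] z - W.a₁ * (℘[L] z - W.b₂ / 12) - W.a₃) / 2 ≠ 0 := by
  set E := ℘[L - (0 : ℂ)] with hE
  set E' := ℘'[L - (0 : ℂ)] with hE'
  set Q : ℂ → ℂ := fun z => 2 + W.a₁ * z + W.a₁ * z ^ 3 * (E z - W.b₂ / 12) + W.a₃ * z ^ 3 -
    z ^ 3 * E' z with hQ
  have hEa : AnalyticAt ℂ E 0 := L.analyticAt_weierstrassPExcept 0
  have hE'a : AnalyticAt ℂ E' 0 := L.analyticAt_derivWeierstrassPExcept 0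
  have hQa : AnalyticAt ℂ Q 0 := by rw [hQ]; fun_prop
  have hQ0 : Q 0 = 2 := by simp [hQ]
  have hQne : ∀ᶠ z in 𝓝 0, Q z ≠ 0 := hQa.continuousAt.eventually_ne (by rw [hQ0]; exact two_ne_zero)
  have hP : ∀ z, ℘[L] z = E z + 1 / z ^ 2 := L.weierstrassP_eq_weierstrassPExcept_add
  have hP' : ∀ z, ℘'[L] z = E' z - 2 / z ^ 3 := L.derivWeierstrassP_eq_derivWeierstrassPExcept_sub
  filter_upwards [mem_nhdsWithin_of_mem_nhds hQne, self_mem_nhdsWithin] with z hzQ hz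
  rw [mem_compl_iff, mem_singleton_iff] at hz
  have hD : (℘'[L] z - W.a₁ * (℘[L] z - W.b₂ / 12) - W.a₃) / 2 = -(Q z) / (2 * z ^ 3) := by
    rw [hP, hP', hQ]
    field_simp
    ring
  rw [hD]
  exact div_ne_zero (neg_ne_zero.mpr hzQ) (mul_ne_zero two_ne_zero (pow_ne_zero 3 hz))

/-- **The formal exponential is the Taylor series of the local parameter along the
uniformisation: `𝓣[t] = exp_W`, `t = -x/y`.** For a Weierstrass model `W/ℂ` and a period pair
`L` of Néron type for it (`g₂(L) = c₄/12`, `g₃(L) = c₆/216`), the meromorphic function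
`t(z) = -x(z)/y(z)`, `(x, y) = (℘ - b₂/12, (℘' - a₁x - a₃)/2)` (extended by `0` on `Λ`) has
Taylor series at `0` equal to the formal exponential `exp_W` of Silverman AEC IV.5 (the tree's
`formalExp`); equivalently `log_W(𝓣[t]) = z`, i.e. `u^*ω = dz`. This identifies the formal leaf
`Graph(exp_{W'} ∘ log_W)` of Bost's line `h` with the germ at `e` of its analytic leaf
`z ↦ (u(z), u'(z))` (Bost 2001, §3.4.1 and the proof of Thm. 2.3, condition ii)).
[cite: Bost2001AlgebraicLeaves, §3.4.1 and Cor. 2.5 (proof)] -/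
theorem taylor_localParam_eq_formalExp (h₂ : L.g₂ = W.c₄ / 12) (h₃ : L.g₃ = W.c₆ / 216) :
    𝓣[(fun z => if z ∈ L.lattice then (0 : ℂ) else
        -(℘[L] z - W.b₂ / 12) / ((℘'[L] z - W.a₁ * (℘[L] z - W.b₂ / 12) - W.a₃) / 2))] =
      W.formalExp := by
  obtain ⟨hta, hwa⟩ := analyticAt_localParam L W
  have hdt := deriv_localParam_zero L W
  have hy := eventually_y_ne_zero L W
  set x : ℂ → ℂ := fun z => ℘[L] z - W.b₂ / 12 with hx
  set y : ℂ → ℂ := fun z => (℘'[L] z - W.a₁ * (℘[L] z - W.b₂ / 12) - W.a₃) / 2 with hydef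
  set t : ℂ → ℂ := fun z => if z ∈ L.lattice then (0 : ℂ) else
    -(℘[L] z - W.b₂ / 12) / ((℘'[L] z - W.a₁ * (℘[L] z - W.b₂ / 12) - W.a₃) / 2) with ht
  set w : ℂ → ℂ := fun z => if z ∈ L.lattice then (0 : ℂ) else
    -1 / ((℘'[L] z - W.a₁ * (℘[L] z - W.b₂ / 12) - W.a₃) / 2) with hw
  have ht0 : t 0 = 0 := by rw [ht]; exact if_pos (zero_mem _)
  have hw0 : w 0 = 0 := by rw [hw]; exact if_pos (zero_mem _)
  have hΛ := L.eventually_nhdsNE_notMem_lattice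
  have htz : ∀ z, z ∉ L.lattice → t z = -x z / y z := fun z hz => by rw [ht]; exact if_neg hz
  have hwz : ∀ z, z ∉ L.lattice → w z = -1 / y z := fun z hz => by rw [hw]; exact if_neg hz
  -- (E1): the Weierstrass equation divided by `y³`
  have hE1 : w =ᶠ[𝓝 0] fun z => t z ^ 3 + W.a₁ * (t * w) z + W.a₂ * (t ^ 2 * w) z +
      W.a₃ * (w ^ 2) z + W.a₄ * (t * w ^ 2) z + W.a₆ * (w ^ 3) z := by
    refine eventually_nhds_of_nhdsNE ?_ (by simp [ht0, hw0])
    filter_upwards [hΛ, hy] with z hzΛ hyz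
    simp only [Pi.mul_apply, Pi.pow_apply]
    rw [htz z hzΛ, hwz z hzΛ]
    have heq := equation_weierstrassP_sub L W h₂ h₃ hzΛ
    change y z ^ 2 + W.a₁ * x z * y z + W.a₃ * y z = x z ^ 3 + W.a₂ * x z ^ 2 + W.a₄ * x z + W.a₆
      at heq
    have key : -1 / y z - ((-x z / y z) ^ 3 + W.a₁ * (-x z / y z * (-1 / y z)) +
        W.a₂ * ((-x z / y z) ^ 2 * (-1 / y z)) + W.a₃ * (-1 / y z) ^ 2 +
        W.a₄ * (-x z / y z * (-1 / y z) ^ 2) + W.a₆ * (-1 / y z) ^ 3) =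
        (-1 / y z ^ 3) * ((y z ^ 2 + W.a₁ * x z * y z + W.a₃ * y z) -
          (x z ^ 3 + W.a₂ * x z ^ 2 + W.a₄ * x z + W.a₆)) := by
      field_simp
      ring
    rw [heq, sub_self, mul_zero, sub_eq_zero] at key
    exact key
  -- (E2): `x' = ℘' = 2y + a₁x + a₃`
  have hE2 : (fun z => deriv t z * w z - t z * deriv w z) =ᶠ[𝓝 0]
      fun z => w z * (-2 + W.a₁ * t z + W.a₃ * w z) := by
    have hL : AnalyticAt ℂ (fun z => deriv t z * w z - t z * deriv w z) 0 := by fun_prop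
    have hR : AnalyticAt ℂ (fun z => w z * (-2 + W.a₁ * t z + W.a₃ * w z)) 0 := by fun_prop
    refine (hL.frequently_eq_iff_eventually_eq hR).mp (Filter.Eventually.frequently ?_)
    filter_upwards [hΛ, hy] with z hzΛ hyz
    have hopen : (L.lattice : Set ℂ)ᶜ ∈ 𝓝 z := L.isClosed_lattice.isOpen_compl.mem_nhds hzΛ
    have hteq : t =ᶠ[𝓝 z] fun v => -x v / y v := by
      filter_upwards [hopen] with v hv
      exact htz v hv
    have hweq : w =ᶠ[𝓝 z] fun v => -1 / y v := by
      filter_upwards [hopen] with v hv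
      exact hwz v hv
    have hPd : HasDerivAt ℘[L] (℘'[L] z) z := by
      have := (L.differentiableOn_weierstrassP.differentiableAt hopen).hasDerivAt
      rwa [L.deriv_weierstrassP] at this
    have hP'd : HasDerivAt ℘'[L] (deriv ℘'[L] z) z :=
      (L.differentiableOn_derivWeierstrassP.differentiableAt hopen).hasDerivAt
    have hxd : HasDerivAt x (℘'[L] z) z := hPd.sub_const _
    have hyd : HasDerivAt y ((deriv ℘'[L] z - W.a₁ * ℘'[L] z) / 2) z := by
      have := ((hP'd.fun_sub (hxd.const_mul W.a₁)).sub_const W.a₃).div_const 2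
      exact this
    have htd := (hxd.fun_neg.fun_div hyd hyz)
    have hwd := ((hasDerivAt_const z (-1 : ℂ)).fun_div hyd hyz)
    rw [hteq.deriv_eq, hweq.deriv_eq, htd.deriv, hwd.deriv, htz z hzΛ, hwz z hzΛ]
    have hyz' : y z ≠ 0 := hyz
    have hP : ℘'[L] z = 2 * y z + W.a₁ * x z + W.a₃ := by simp only [hydef, hx]; ring
    rw [hP]
    field_simp
    ring
  -- Taylor series
  have hT0 : constantCoeff 𝓣[t] = 0 := by rw [constantCoeff_taylor, ht0]
  have hT1 : coeff 1 𝓣[t] = 1 := by rw [coeff_one_taylor, hdt]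
  have hY0 : constantCoeff 𝓣[w] = 0 := by rw [constantCoeff_taylor, hw0]
  have hfun1 : (fun z => t z ^ 3 + W.a₁ * (t * w) z + W.a₂ * (t ^ 2 * w) z +
      W.a₃ * (w ^ 2) z + W.a₄ * (t * w ^ 2) z + W.a₆ * (w ^ 3) z) =
      t ^ 3 + (fun z => W.a₁ * (t * w) z) + (fun z => W.a₂ * (t ^ 2 * w) z) +
        (fun z => W.a₃ * (w ^ 2) z) + (fun z => W.a₄ * (t * w ^ 2) z) +
        (fun z => W.a₆ * (w ^ 3) z) := by
    funext z
    simp only [Pi.add_apply, Pi.pow_apply]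
  have h1 : AnalyticAt ℂ (t ^ 3) 0 := hta.pow 3
  have h2 : AnalyticAt ℂ (fun z => W.a₁ * (t * w) z) 0 := analyticAt_const.fun_mul (hta.mul hwa)
  have h3 : AnalyticAt ℂ (fun z => W.a₂ * (t ^ 2 * w) z) 0 :=
    analyticAt_const.fun_mul ((hta.pow 2).mul hwa)
  have h4 : AnalyticAt ℂ (fun z => W.a₃ * (w ^ 2) z) 0 := analyticAt_const.fun_mul (hwa.pow 2)
  have h5 : AnalyticAt ℂ (fun z => W.a₄ * (t * w ^ 2) z) 0 :=
    analyticAt_const.fun_mul (hta.mul (hwa.pow 2))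
  have h6 : AnalyticAt ℂ (fun z => W.a₆ * (w ^ 3) z) 0 := analyticAt_const.fun_mul (hwa.pow 3)
  have hF1 : 𝓣[w] = 𝓣[t] ^ 3 + C W.a₁ * 𝓣[t] * 𝓣[w] + C W.a₂ * 𝓣[t] ^ 2 * 𝓣[w] +
      C W.a₃ * 𝓣[w] ^ 2 + C W.a₄ * 𝓣[t] * 𝓣[w] ^ 2 + C W.a₆ * 𝓣[w] ^ 3 := by
    have h := taylor_congr hE1
    rw [hfun1,
      taylor_add ((((h1.add h2).add h3).add h4).add h5) h6,
      taylor_add (((h1.add h2).add h3).add h4) h5, taylor_add ((h1.add h2).add h3) h4,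
      taylor_add (h1.add h2) h3, taylor_add h1 h2, taylor_pow hta 3,
      taylor_const_mul, taylor_mul hta hwa, taylor_const_mul, taylor_mul (hta.pow 2) hwa,
      taylor_pow hta 2, taylor_const_mul, taylor_pow hwa 2, taylor_const_mul,
      taylor_mul hta (hwa.pow 2), taylor_pow hwa 2, taylor_const_mul, taylor_pow hwa 3] at h
    refine h.trans ?_
    ring
  have hfun2 : (fun z => deriv t z * w z - t z * deriv w z) = deriv t * w - t * deriv w := by
    funext z
    simp only [Pi.sub_apply, Pi.mul_apply]
  have hfun3 : (fun z => w z * (-2 + W.a₁ * t z + W.a₃ * w z)) =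
      w * ((fun _ => (-2 : ℂ)) + (fun z => W.a₁ * t z) + (fun z => W.a₃ * w z)) := by
    funext z
    simp only [Pi.add_apply, Pi.mul_apply]
  have g1 : AnalyticAt ℂ (deriv t * w) 0 := hta.deriv.mul hwa
  have g2 : AnalyticAt ℂ (t * deriv w) 0 := hta.mul hwa.deriv
  have g3 : AnalyticAt ℂ (fun _ : ℂ => (-2 : ℂ)) 0 := analyticAt_const
  have g4 : AnalyticAt ℂ (fun z => W.a₁ * t z) 0 := analyticAt_const.fun_mul hta
  have g5 : AnalyticAt ℂ (fun z => W.a₃ * w z) 0 := analyticAt_const.fun_mul hwa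
  have hF2 : d⁄dX ℂ 𝓣[t] * 𝓣[w] - 𝓣[t] * d⁄dX ℂ 𝓣[w] =
      𝓣[w] * (-2 + C W.a₁ * 𝓣[t] + C W.a₃ * 𝓣[w]) := by
    have h := taylor_congr hE2
    rw [hfun2, hfun3, taylor_sub g1 g2, taylor_mul hta.deriv hwa, taylor_mul hta hwa.deriv,
      taylor_deriv, taylor_deriv, taylor_mul hwa ((g3.add g4).add g5), taylor_add (g3.add g4) g5,
      taylor_add g3 g4, taylor_const, taylor_const_mul, taylor_const_mul] at h
    rw [h]
    congr 1
    have hC2 : (C (-2 : ℂ) : ℂ⟦X⟧) = -2 := by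
      rw [map_neg, (map_ofNat C 2 : C (2 : ℂ) = (2 : ℂ⟦X⟧))]
    rw [hC2]
  exact (W.eq_formalExp_of_flow hT0 hT1 hY0 hF1 hF2).symm ▸ rfl

/-- **`y(𝓣[t₁]) = 𝓣[t₂]` for the strict formal isomorphism `y = exp_{W₂}(log_{W₁} x)`** of the
formal groups of two Weierstrass models over `ℂ` with Néron period pairs: the hypothesis
"`y(φ̂) = ψ̂`" (simultaneous uniformisation) of André's criterion in the tree's form
(`Transcendental/AndreCriterionAnalyticProofs`, `hy`) for `(φ, ψ) = (t₁, t₂)`, the local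
parameters along the two uniformisations. [cite: Bost2001AlgebraicLeaves, Cor. 2.5 (proof)] -/
theorem formalExp_subst_formalLog_subst_taylor (L₁ L₂ : PeriodPair) (W₁ W₂ : WeierstrassCurve ℂ)
    (h₁₂ : L₁.g₂ = W₁.c₄ / 12) (h₁₃ : L₁.g₃ = W₁.c₆ / 216) (h₂₂ : L₂.g₂ = W₂.c₄ / 12)
    (h₂₃ : L₂.g₃ = W₂.c₆ / 216) :
    PowerSeries.subst
        𝓣[(fun z => if z ∈ L₁.lattice then (0 : ℂ) else
          -(℘[L₁] z - W₁.b₂ / 12) / ((℘'[L₁] z - W₁.a₁ * (℘[L₁] z - W₁.b₂ / 12) - W₁.a₃) / 2))]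
        (W₂.formalExp.subst W₁.formalLog) =
      𝓣[(fun z => if z ∈ L₂.lattice then (0 : ℂ) else
          -(℘[L₂] z - W₂.b₂ / 12) / ((℘'[L₂] z - W₂.a₁ * (℘[L₂] z - W₂.b₂ / 12) - W₂.a₃) / 2))] := by
  rw [taylor_localParam_eq_formalExp L₁ W₁ h₁₂ h₁₃, taylor_localParam_eq_formalExp L₂ W₂ h₂₂ h₂₃,
    PowerSeries.subst_comp_subst_apply W₁.hasSubst_formalLog
      (HasSubst.of_constantCoeff_zero' W₁.constantCoeff_formalExp),
    formalLog_subst_formalExp, X_subst]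


end Analytic

end WeierstrassCurve

end
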